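import Literature.Probability.LatticeModels.BattleFederbushExpansion
import Mathlib.Data.Real.Basic
import HarnessLib

/-!
# The tree-decay lemma for extended (kernel-weighted) vertices

Topic `Literature/Probability/LatticeModels`; a companion of `BattleFederbushTreeDecay.lean` and
`TreeScaleSums.lean`.  There the positions of the POINTS of a rooted tree (a script `s : Script root k`)
were summed against two-point line weights: `Σ_{x : x_root = a} ∏_ℓ g_ℓ ≤ ∏_ℓ B_ℓ` when the row sums of the
line weights are `≤ B_ℓ`.  Below the first scale of a multiscale (cluster / renormalisation-group)
expansion the vertices of the tree expansion are EXTENDED: the vertex `u` is a monomial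
`∫ dx₁⋯dx_m W_u(x₁,…,x_m) ψ(x₁)⋯ψ(x_m)` whose fields sit at independent points, weighted by a kernel
controlled in the `L¹–L^∞` norm `max_i sup_{x_i} ∫ ∏_{j≠i} dx_j |W_u|` (Gawȩdzki–Kupiainen 1985;
Benfatto–Giuliani–Mastropietro 2006, (2.67)–(2.70) and the bound (2.77); Gentile–Mastropietro 2001, §4;
Salmhofer 1998, §4.1), and each tree line joins one field of a vertex to one field of another.  The
positions are then summed by PEELING THE LEAVES: the last point of the script is a leaf; its kernel is summed
with the slot where the line enters pinned (`≤ N`), then that slot against the line weight (`≤ Γ`).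

* the fields occupy slots `τ : S` of the points (`cS τ : ι`) at positions `x τ ∈ Λ` (a finite abelian
  group); `sum_filter_insert_eq_sum_sum` splits a sum over the slot positions of the points of
  `insert z Q` into the positions of the slots of `Q` and of `z` (recombined by addition);
* `sum_kernel_mul_twoPoint_le` — one leaf: `Σ_y K(y) h(b, y τ) ≤ Γ N`;
* **`sum_kernelProd_lineProd_le`** — for a valid script, kernels `K u ≥ 0` depending only on the slots
  of `u` with `Σ_{slots of u, any one pinned} K u ≤ N u`, and line weights `w ℓ x = h(x τ₁, x τ₂)` joining
  the two points of `ℓ` with row and column sums `≤ Γ`: the root slot `τ₀` being pinned and the slots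
  outside the script frozen,
  `Σ_x (∏_{u ∈ script} K u x) ∏_{ℓ ∈ lines} w ℓ x ≤ N(root) · Γ^k · ∏_{m=1}^{k} N(y_m)`.

Everything is proved; no named fact. [folklore]

## Sources

G. Benfatto, A. Giuliani, V. Mastropietro, Ann. Henri Poincaré 7 (2006) 809–898, proof of (2.77)
(`BenfattoGiulianiMastropietro2006`); K. Gawȩdzki, A. Kupiainen, Comm. Math. Phys. 102 (1985) 1–30, §3
(`GawedzkiKupiainen1985GrossNeveu`); M. Salmhofer, Comm. Math. Phys. 194 (1998) 249–295, §4.1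
(`Salmhofer1998`); D. C. Brydges, Les Houches 1984, §3 (`Brydges1986`).
-/

noncomputable section

open Finset

namespace Literature.Probability.LatticeModels

namespace BattleFederbush

variable {ι : Type*} [DecidableEq ι] {v : ι}
/-! ### The point sets of scripts -/

section Peeling

variable {S : Type*} [Fintype S] [DecidableEq S] {Λ : Type*} [AddCommGroup Λ] [Fintype Λ] [DecidableEq Λ]

/-- The root script has the root as its only point. [folklore] -/
theorem Script.image_y_nil (v : ι) : (univ : Finset (Fin 1)).image (Script.nil : Script v 0).y = {v} := by
  ext u
  simp [eq_comm]

/-- The point set of an extended script. [folklore] -/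
theorem Script.image_y_snoc {k : ℕ} (s : Script v k) (i : Fin (k + 1)) (z : ι) :
    (univ : Finset (Fin (k + 2))).image (Script.snoc s i z).y = insert z (univ.image s.y) := by
  ext u
  simp only [mem_image, mem_univ, true_and, mem_insert]
  constructor
  · rintro ⟨m, rfl⟩
    induction m using Fin.lastCases with
    | last => exact Or.inl (Script.y_snoc_last s i z)
    | cast m => exact Or.inr ⟨m, by rw [Script.y_snoc_castSucc]⟩
  · rintro (h | ⟨m, rfl⟩)
    · exact ⟨Fin.last _, by rw [Script.y_snoc_last, h]⟩
    · exact ⟨m.castSucc, Script.y_snoc_castSucc s i z m⟩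

/-! ### Peeling the leaves -/

/-- **Splitting off the slots of one cluster**: a sum over the slot positions which are pinned at `τ₀`,
free on the clusters of `insert z Q` and frozen at `0` elsewhere is the iterated sum over the positions
free on `Q` (frozen elsewhere, in particular on the slots of `z ∉ Q`) and the positions of the slots of
`z` (frozen elsewhere), the two being recombined by addition. [folklore] -/
theorem sum_filter_insert_eq_sum_sum (cS : S → ι) (Q : Finset ι) {z : ι} (hz : z ∉ Q) {τ₀ : S} (hτ₀ : cS τ₀ ∈ Q) (a : Λ)
    (Φ : (S → Λ) → ℝ) :
    ∑ x ∈ univ.filter (fun x : S → Λ => x τ₀ = a ∧ ∀ τ, cS τ ∉ insert z Q → x τ = 0), Φ x =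
      ∑ x' ∈ univ.filter (fun x : S → Λ => x τ₀ = a ∧ ∀ τ, cS τ ∉ Q → x τ = 0),
        ∑ y ∈ univ.filter (fun y : S → Λ => ∀ τ, cS τ ≠ z → y τ = 0), Φ (x' + y) := by
  classical
  have hτ₀z : cS τ₀ ≠ z := fun h => hz (h ▸ hτ₀)
  -- the two parts of a configuration
  set rOf : (S → Λ) → (S → Λ) := fun x τ => if cS τ = z then 0 else x τ with hrOf
  set yOf : (S → Λ) → (S → Λ) := fun x τ => if cS τ = z then x τ else 0 with hyOf
  rw [← sum_product' (univ.filter fun x : S → Λ => x τ₀ = a ∧ ∀ τ, cS τ ∉ Q → x τ = 0)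
    (univ.filter fun y : S → Λ => ∀ τ, cS τ ≠ z → y τ = 0) fun x' y => Φ (x' + y)]
  refine sum_nbij' (fun x => (rOf x, yOf x)) (fun p => p.1 + p.2) ?_ ?_ ?_ ?_ ?_
  · intro x hx
    obtain ⟨hxa, hx0⟩ := (mem_filter.1 hx).2
    refine mem_product.2 ⟨mem_filter.2 ⟨mem_univ _, ?_, fun τ hτ => ?_⟩, mem_filter.2 ⟨mem_univ _, fun τ hτ => ?_⟩⟩
    · simp [hrOf, hτ₀z, hxa]
    · by_cases h : cS τ = z
      · simp [hrOf, h]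
      · simp only [hrOf, h, if_false]
        exact hx0 τ (by rw [mem_insert, not_or]; exact ⟨h, hτ⟩)
    · simp [hyOf, hτ]
  · rintro ⟨x', y⟩ hp
    obtain ⟨hx', hy⟩ := mem_product.1 hp
    obtain ⟨hxa, hx0⟩ := (mem_filter.1 hx').2
    have hy0 := (mem_filter.1 hy).2
    dsimp only at hxa hx0 hy0 ⊢
    refine mem_filter.2 ⟨mem_univ _, ?_, fun τ hτ => ?_⟩
    · rw [Pi.add_apply, hxa, hy0 τ₀ hτ₀z, add_zero]
    · rw [mem_insert, not_or] at hτ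
      rw [Pi.add_apply, hx0 τ hτ.2, hy0 τ hτ.1, add_zero]
  · intro x _
    funext τ
    by_cases h : cS τ = z <;> simp [hrOf, hyOf, h]
  · rintro ⟨x', y⟩ hp
    obtain ⟨hx', hy⟩ := mem_product.1 hp
    obtain ⟨-, hx0⟩ := (mem_filter.1 hx').2
    have hy0 := (mem_filter.1 hy).2
    dsimp only at hx0 hy0
    refine Prod.ext ?_ ?_
    · funext τ
      by_cases h : cS τ = z
      · simp only [hrOf, h, if_true]
        exact (hx0 τ (h ▸ hz)).symm
      · simp only [hrOf, h, if_false, Pi.add_apply]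
        rw [hy0 τ h, add_zero]
    · funext τ
      by_cases h : cS τ = z
      · simp only [hyOf, h, if_true, Pi.add_apply]
        rw [hx0 τ (h ▸ hz), zero_add]
      · simp only [hyOf, h, if_false]
        exact (hy0 τ h).symm
  · intro x _
    show Φ x = Φ (rOf x + yOf x)
    congr 1
    funext τ
    by_cases h : cS τ = z <;> simp [hrOf, hyOf, h]

/-- **Summing a vertex kernel against the line entering it**: if `Σ_{slot τ pinned} K ≤ N` and the
two-point weight has row sums `≤ Γ`, then `Σ_y K(y) h(b, y τ) ≤ Γ N`. [folklore] -/
theorem sum_kernel_mul_twoPoint_le (cS : S → ι) {z : ι}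
    (Kz : (S → Λ) → ℝ) (hK0 : ∀ y, 0 ≤ Kz y) {Nz : ℝ} {τ : S}
    (hKN : ∀ a' : Λ, ∑ y ∈ univ.filter (fun y : S → Λ => y τ = a' ∧ ∀ τ', cS τ' ≠ z → y τ' = 0), Kz y ≤ Nz)
    (g : Λ → ℝ) (hg0 : ∀ a', 0 ≤ g a') {Γ : ℝ} (hg : ∑ a', g a' ≤ Γ) :
    ∑ y ∈ univ.filter (fun y : S → Λ => ∀ τ', cS τ' ≠ z → y τ' = 0), Kz y * g (y τ) ≤ Γ * Nz := by
  classical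
  have hNz : 0 ≤ Nz := le_trans (sum_nonneg fun y _ => hK0 y) (hKN 0)
  rw [← sum_fiberwise (univ.filter fun y : S → Λ => ∀ τ', cS τ' ≠ z → y τ' = 0) (fun y => y τ)
    fun y => Kz y * g (y τ)]
  calc ∑ a' : Λ, ∑ y ∈ (univ.filter fun y : S → Λ => ∀ τ', cS τ' ≠ z → y τ' = 0) with y τ = a', Kz y * g (y τ)
      = ∑ a' : Λ, g a' * ∑ y ∈ univ.filter (fun y : S → Λ => y τ = a' ∧ ∀ τ', cS τ' ≠ z → y τ' = 0), Kz y := by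
        refine sum_congr rfl fun a' _ => ?_
        rw [Finset.mul_sum, filter_filter]
        refine sum_congr (filter_congr fun y _ => ⟨fun h => ⟨h.2, h.1⟩, fun h => ⟨h.2, h.1⟩⟩) fun y hy => ?_
        rw [(mem_filter.1 hy).2.1, mul_comm]
    _ ≤ ∑ a' : Λ, g a' * Nz := sum_le_sum fun a' _ => mul_le_mul_of_nonneg_left (hKN a') (hg0 a')
    _ = (∑ a', g a') * Nz := by rw [Finset.sum_mul]
    _ ≤ Γ * Nz := mul_le_mul_of_nonneg_right hg hNz

/-- **The tree-decay lemma for extended vertices** (peeling the leaves; Benfatto–Giuliani–Mastropietro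
2006, proof of (2.77), with kernels in the `L¹–L^∞` norm of Gawȩdzki–Kupiainen / Salmhofer): the fields
occupy slots `τ : S` of the clusters, at positions `x τ ∈ Λ`; the cluster `u` carries a kernel `K u x ≥ 0`
depending only on the positions of its own slots, whose sum over those positions with ANY one slot pinned
is `≤ N u`; the line `ℓ` of the script carries a two-slot weight `w ℓ x = h(x τ₁, x τ₂)` joining its two
clusters, with row and column sums `≤ Γ`.  Then, a slot of the root being pinned and the slots outside the
script frozen,
`Σ_x (∏_{u ∈ script} K u x) ∏_{ℓ ∈ lines} w ℓ x ≤ N(root) · Γ^k · ∏_{m = 1}^{k} N(y_m)`.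
[cite: BenfattoGiulianiMastropietro2006, proof of (2.77)] -/
theorem sum_kernelProd_lineProd_le (cS : S → ι) (K : ι → (S → Λ) → ℝ) (hK0 : ∀ u x, 0 ≤ K u x)
    (hKloc : ∀ u x x', (∀ τ, cS τ = u → x τ = x' τ) → K u x = K u x')
    (N : ι → ℝ) (hKN : ∀ u τ, cS τ = u → ∀ a : Λ,
      ∑ x ∈ univ.filter (fun x : S → Λ => x τ = a ∧ ∀ τ', cS τ' ≠ u → x τ' = 0), K u x ≤ N u)
    {Γ : ℝ} (hΓ : 0 ≤ Γ) (w : Sym2 ι → (S → Λ) → ℝ) :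
    ∀ {k : ℕ} (s : Script v k), s.Valid →
      (∀ ℓ ∈ s.lines, ∃ (τ₁ τ₂ : S) (h : Λ → Λ → ℝ), s(cS τ₁, cS τ₂) = ℓ ∧
        (∀ x, w ℓ x = h (x τ₁) (x τ₂)) ∧ (∀ b b', 0 ≤ h b b') ∧
        (∀ b, ∑ b', h b b' ≤ Γ) ∧ (∀ b', ∑ b, h b b' ≤ Γ)) →
      ∀ (τ₀ : S), cS τ₀ = v → ∀ a : Λ,
        ∑ x ∈ univ.filter (fun x : S → Λ => x τ₀ = a ∧ ∀ τ, cS τ ∉ univ.image s.y → x τ = 0),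
            (∏ u ∈ univ.image s.y, K u x) * (s.lines.map fun ℓ => w ℓ x).prod ≤
          N v * (Γ ^ k * ∏ m : Fin k, N (s.y m.succ))
  | _, Script.nil, _, _, τ₀, hτ₀, a => by
    rw [Script.image_y_nil, pow_zero, one_mul, Fintype.prod_empty, mul_one]
    simp only [prod_singleton, Script.lines, List.map_nil, List.prod_nil, mul_one, mem_singleton]
    simpa using hKN v τ₀ hτ₀ a
  | k + 1, Script.snoc s i z, hv, hw, τ₀, hτ₀, a => by
    classical
    obtain ⟨hs, hz⟩ := hv
    set Q := (univ : Finset (Fin (k + 1))).image s.y with hQ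
    have hzQ : z ∉ Q := fun h => by
      obtain ⟨m, -, hm⟩ := mem_image.1 h; exact hz m hm
    have hvQ : v ∈ Q := mem_image.2 ⟨0, mem_univ _, Script.y_zero s⟩
    have hτ₀Q : cS τ₀ ∈ Q := hτ₀ ▸ hvQ
    -- the last line and its two-slot weight
    have hlines : (Script.snoc s i z).lines = s.lines ++ [s(s.y i, z)] := rfl
    obtain ⟨τ₁, τ₂, h, h12, hwh, hh0, hrow, hcol⟩ := hw s(s.y i, z) (by rw [hlines]; simp)
    -- the induction hypothesis
    have ih := sum_kernelProd_lineProd_le cS K hK0 hKloc N hKN hΓ w s hs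
      (fun ℓ hℓ => hw ℓ (by rw [hlines]; exact List.mem_append_left _ hℓ)) τ₀ hτ₀ a
    -- nonnegativity of the old weight
    have hR0 : ∀ x : S → Λ, 0 ≤ (∏ u ∈ Q, K u x) * (s.lines.map fun ℓ => w ℓ x).prod := fun x => by
      refine mul_nonneg (prod_nonneg fun u _ => hK0 u x) (List.prod_nonneg fun r hr => ?_)
      obtain ⟨ℓ, hℓ, rfl⟩ := List.mem_map.1 hr
      obtain ⟨σ₁, σ₂, h', -, hwh', hh0', -, -⟩ := hw ℓ (by rw [hlines]; exact List.mem_append_left _ hℓ)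
      rw [hwh']; exact hh0' _ _
    have hNz : 0 ≤ N z := by
      rcases Sym2.eq_iff.1 h12 with ⟨-, h2⟩ | ⟨h1, -⟩
      · exact le_trans (sum_nonneg fun y _ => hK0 z y) (hKN z τ₂ h2 0)
      · exact le_trans (sum_nonneg fun y _ => hK0 z y) (hKN z τ₁ h1 0)
    -- split off the slots of `z`
    rw [Script.image_y_snoc, sum_filter_insert_eq_sum_sum cS Q hzQ hτ₀Q a]
    -- the summand at `x' + y`
    have hsummand : ∀ x' ∈ univ.filter (fun x : S → Λ => x τ₀ = a ∧ ∀ τ, cS τ ∉ Q → x τ = 0),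
        ∀ y ∈ univ.filter (fun y : S → Λ => ∀ τ, cS τ ≠ z → y τ = 0),
        (∏ u ∈ insert z Q, K u (x' + y)) * ((Script.snoc s i z).lines.map fun ℓ => w ℓ (x' + y)).prod =
          ((∏ u ∈ Q, K u x') * (s.lines.map fun ℓ => w ℓ x').prod) *
            (K z y * h ((x' + y) τ₁) ((x' + y) τ₂)) := by
      intro x' hx' y hy
      obtain ⟨-, hx0⟩ := (mem_filter.1 hx').2
      have hy0 := (mem_filter.1 hy).2
      -- agreement of `x' + y` with `x'` off the slots of `z`, with `y` on them
      have hoff : ∀ τ, cS τ ≠ z → (x' + y) τ = x' τ := fun τ hτ => by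
        rw [Pi.add_apply, hy0 τ hτ, add_zero]
      have hon : ∀ τ, cS τ = z → (x' + y) τ = y τ := fun τ hτ => by
        rw [Pi.add_apply, hx0 τ (hτ ▸ hzQ), zero_add]
      have hKQ : ∏ u ∈ Q, K u (x' + y) = ∏ u ∈ Q, K u x' := by
        refine prod_congr rfl fun u hu => hKloc u _ _ fun τ hτ => hoff τ ?_
        rintro rfl; exact hzQ (hτ ▸ hu)
      have hKz : K z (x' + y) = K z y := hKloc z _ _ fun τ hτ => hon τ hτ
      have hwQ : (s.lines.map fun ℓ => w ℓ (x' + y)) = s.lines.map fun ℓ => w ℓ x' := by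
        refine List.map_congr_left fun ℓ hℓ => ?_
        obtain ⟨σ₁, σ₂, h', h12', hwh', -, -, -⟩ := hw ℓ (by rw [hlines]; exact List.mem_append_left _ hℓ)
        have hσ : ∀ σ ∈ s(cS σ₁, cS σ₂), cS σ₁ = σ ∨ cS σ₂ = σ → σ ≠ z := by
          intro σ hσ _ hσz
          have hm := Script.mem_image_of_mem_lines s ℓ hℓ σ (h12' ▸ hσ)
          exact hzQ (hσz ▸ hm)
        rw [hwh', hwh', hoff σ₁ (hσ _ (Sym2.mem_mk_left _ _) (Or.inl rfl)),
          hoff σ₂ (hσ _ (Sym2.mem_mk_right _ _) (Or.inr rfl))]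
      rw [prod_insert hzQ, hlines, List.map_append, List.prod_append, List.map_singleton,
        List.prod_singleton, hKQ, hKz, hwQ, hwh]
      ring
    rw [sum_congr rfl fun x' hx' => sum_congr rfl fun y hy => hsummand x' hx' y hy]
    -- the inner sum over the slots of `z`
    have hinner : ∀ x' ∈ univ.filter (fun x : S → Λ => x τ₀ = a ∧ ∀ τ, cS τ ∉ Q → x τ = 0),
        ∑ y ∈ univ.filter (fun y : S → Λ => ∀ τ, cS τ ≠ z → y τ = 0),
          K z y * h ((x' + y) τ₁) ((x' + y) τ₂) ≤ Γ * N z := by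
      intro x' hx'
      obtain ⟨-, hx0⟩ := (mem_filter.1 hx').2
      rcases Sym2.eq_iff.1 h12 with ⟨h1, h2⟩ | ⟨h1, h2⟩
      · -- `τ₁` in the parent `s.y i`, `τ₂` in the new point `z`
        have h1z : cS τ₁ ≠ z := by rw [h1]; exact fun h' => hz i h'
        calc ∑ y ∈ univ.filter (fun y : S → Λ => ∀ τ, cS τ ≠ z → y τ = 0),
              K z y * h ((x' + y) τ₁) ((x' + y) τ₂)
            = ∑ y ∈ univ.filter (fun y : S → Λ => ∀ τ, cS τ ≠ z → y τ = 0),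
                K z y * h (x' τ₁) (y τ₂) := by
              refine sum_congr rfl fun y hy => ?_
              have hy0 := (mem_filter.1 hy).2
              rw [Pi.add_apply, Pi.add_apply, hy0 τ₁ h1z, add_zero, hx0 τ₂ (h2 ▸ hzQ), zero_add]
          _ ≤ Γ * N z := sum_kernel_mul_twoPoint_le cS (K z) (hK0 z) (hKN z τ₂ h2) (h (x' τ₁))
              (hh0 _) (hrow _)
      · -- `τ₁` in the new point `z`, `τ₂` in the parent
        have h2z : cS τ₂ ≠ z := by rw [h2]; exact fun h' => hz i h'
        calc ∑ y ∈ univ.filter (fun y : S → Λ => ∀ τ, cS τ ≠ z → y τ = 0),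
              K z y * h ((x' + y) τ₁) ((x' + y) τ₂)
            = ∑ y ∈ univ.filter (fun y : S → Λ => ∀ τ, cS τ ≠ z → y τ = 0),
                K z y * (fun b => h b (x' τ₂)) (y τ₁) := by
              refine sum_congr rfl fun y hy => ?_
              have hy0 := (mem_filter.1 hy).2
              rw [Pi.add_apply, Pi.add_apply, hy0 τ₂ h2z, add_zero, hx0 τ₁ (h1 ▸ hzQ), zero_add]
          _ ≤ Γ * N z := sum_kernel_mul_twoPoint_le cS (K z) (hK0 z) (hKN z τ₁ h1) (fun b => h b (x' τ₂))
              (fun b => hh0 _ _) (hcol _)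
    -- assemble
    calc ∑ x' ∈ univ.filter (fun x : S → Λ => x τ₀ = a ∧ ∀ τ, cS τ ∉ Q → x τ = 0),
          ∑ y ∈ univ.filter (fun y : S → Λ => ∀ τ, cS τ ≠ z → y τ = 0),
            ((∏ u ∈ Q, K u x') * (s.lines.map fun ℓ => w ℓ x').prod) *
              (K z y * h ((x' + y) τ₁) ((x' + y) τ₂))
        = ∑ x' ∈ univ.filter (fun x : S → Λ => x τ₀ = a ∧ ∀ τ, cS τ ∉ Q → x τ = 0),
            ((∏ u ∈ Q, K u x') * (s.lines.map fun ℓ => w ℓ x').prod) *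
              ∑ y ∈ univ.filter (fun y : S → Λ => ∀ τ, cS τ ≠ z → y τ = 0),
                K z y * h ((x' + y) τ₁) ((x' + y) τ₂) := by
          refine sum_congr rfl fun x' _ => ?_
          rw [Finset.mul_sum]
      _ ≤ ∑ x' ∈ univ.filter (fun x : S → Λ => x τ₀ = a ∧ ∀ τ, cS τ ∉ Q → x τ = 0),
            ((∏ u ∈ Q, K u x') * (s.lines.map fun ℓ => w ℓ x').prod) * (Γ * N z) :=
          sum_le_sum fun x' hx' => mul_le_mul_of_nonneg_left (hinner x' hx') (hR0 x')
      _ ≤ N v * (Γ ^ k * ∏ m : Fin k, N (s.y m.succ)) * (Γ * N z) := by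
          rw [← Finset.sum_mul]
          exact mul_le_mul_of_nonneg_right ih (mul_nonneg hΓ hNz)
      _ = N v * (Γ ^ (k + 1) * ∏ m : Fin (k + 1), N ((Script.snoc s i z).y m.succ)) := by
          rw [Fin.prod_univ_castSucc, pow_succ]
          have hlast : (Script.snoc s i z).y (Fin.last k).succ = z := by
            rw [Fin.succ_last, Script.y_snoc_last]
          have hcast : ∀ m : Fin k, (Script.snoc s i z).y m.castSucc.succ = s.y m.succ := fun m => by
            rw [Fin.succ_castSucc, Script.y_snoc_castSucc]
          simp only [hlast, hcast]
          ring

end Peeling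

end BattleFederbush

end Literature.Probability.LatticeModels
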